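import Summits.PneNP.PneNP.Theses.KarlinRubin
import Summits.PneNP.PneNP.Theorems.KarlinRubinMonotoneBlindStubAdvIdentity
import Summits.PneNP.PneNP.Theorems.KarlinRubinMonotoneBlindDelta

/-!
# Crux `MonotoneBlind` (stmt-PneNP-18027, route KarlinRubin), line `Sketch`: stub `stub_stageIdentity`

The STAGE (vertex-ignition) identity — one step of the stage decomposition of the minimal-completion
framework of line `Sketch` of crux stmt-PneNP-18027. Write `P_j := Pr_{G(n,1/2,j)}[f = 1]` for the
acceptance of a test `f : EdgeVec n → Bool` under a planted uniform `j`-clique (`plantedCliqueDist n j`;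
`P_0` is the null acceptance). For MONOTONE `f` (pointwise order on `EdgeVec n`, `false < true`) and
`j + 1 ≤ n`:

  `P_{j+1} = P_j + (#kSubsets n j)⁻¹ Σ_{A ∈ kSubsets n j} (n - j)⁻¹ Σ_{v ∉ A}
              Pr_x[f (plant A x) = 0 ∧ f (plant (insert v A) x) = 1]`

— the second summand is the STAGE-`j` REVIVAL MASS: a uniform `j`-set `A`, a uniform outside vertex `v`
(there are `n - j` of them), and the event that the star of `v` into `A` revives `f` — `stub_stageIdentity`.

Proof.
* COUPLING (`avg_kSubsets_succ_eq_avg_insert`): a uniform `(j+1)`-subset of `Fin n` is `insert v A` for a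
  uniform `j`-subset `A` and a uniform vertex `v ∉ A`, because every `(j+1)`-set `S` arises from exactly the
  `j + 1` pairs `(S.erase v, v)`, `v ∈ S` (double count `sum_powersetCard_univ_sum_sdiff_insert`, a
  `Finset.sum_bij'` between two sigma types), and `C(n,j) (n-j) = C(n,j+1) (j+1)`
  (`Nat.choose_succ_right_eq`).
* Fibre `P_{j+1}` over the planted set (`plantedCliqueDist_toOuterMeasure_eq_sum`) and re-average over the
  pairs `(A, v)` by the coupling.
* For each pair, `{x | f (plant (insert v A) x) = 1}` is the DISJOINT union of `{x | f (plant A x) = 1}`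
  (`plant A x ≤ plant (insert v A) x`, `plant_mono_set`, and `f` is monotone) and the revival event; the outer
  measure of a `PMF` is additive on disjoint sets (`erdosRenyiHalf_plant_accept_eq_add_of_subset`, the
  two-set form of the sibling `erdosRenyiHalf_plant_accept_eq_add`).
* Average: the first parts do not depend on `v` and `#(univ \ A) = n - j`, so they re-assemble `P_j`
  (`plantedCliqueDist_toOuterMeasure_eq_sum` again).

All `--supports stmt-PneNP-18027`; no definitions.
-/

set_option linter.dupNamespace false -- `Summit.PneNP.PneNP.…` is the layout-mandated namespace

namespace Summit.PneNP.PneNP.Theorems.MonotoneBlind.VertexCover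

open Literature.Computability.Complexity Literature.Probability.RandomGraphs.PlantedClique Filter Finset
open scoped ENNReal Topology Classical

variable {n : ℕ}

/-! ### The coupling: uniform `(j+1)`-set = uniform `j`-set + uniform outside vertex -/

-- adapted from `Summit.CriticalPhenomena.Ising3DConformalLimit.PlantedPinningCeiling.sum_powersetCard_sum_sdiff_insert`
/-- **Double count of (set, new vertex) pairs.** Summing `g (insert v A)` over the `j`-subsets `A` of
`Fin n` and the vertices `v ∉ A` counts every `(j+1)`-subset `S` exactly `j + 1` times (the pairs
`(S.erase v, v)`, `v ∈ S`): `Σ_{|A| = j} Σ_{v ∉ A} g (insert v A) = (j+1) Σ_{|S| = j+1} g S`. [folklore] -/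
theorem sum_powersetCard_univ_sum_sdiff_insert (j : ℕ) (g : Finset (Fin n) → ℝ≥0∞) :
    ∑ A ∈ powersetCard j (univ : Finset (Fin n)), ∑ v ∈ univ \ A, g (insert v A) =
      ((j + 1 : ℕ) : ℝ≥0∞) * ∑ S ∈ powersetCard (j + 1) (univ : Finset (Fin n)), g S := by
  have h1 : ∑ A ∈ powersetCard j (univ : Finset (Fin n)), ∑ v ∈ univ \ A, g (insert v A) =
      ∑ p ∈ (powersetCard j (univ : Finset (Fin n))).sigma (fun A => univ \ A), g (insert p.2 p.1) := by
    rw [sum_sigma]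
  have h2 : ∑ S ∈ powersetCard (j + 1) (univ : Finset (Fin n)), ∑ _v ∈ S, g S =
      ∑ q ∈ (powersetCard (j + 1) (univ : Finset (Fin n))).sigma (fun S => S), g q.1 := by
    rw [sum_sigma]
  -- the bijection `(A, v) ↦ (insert v A, v)`, inverse `(S, v) ↦ (S.erase v, v)`
  have h3 : ∑ p ∈ (powersetCard j (univ : Finset (Fin n))).sigma (fun A => univ \ A), g (insert p.2 p.1) =
      ∑ q ∈ (powersetCard (j + 1) (univ : Finset (Fin n))).sigma (fun S => S), g q.1 := by
    refine sum_bij' (fun p _ => ⟨insert p.2 p.1, p.2⟩) (fun q _ => ⟨q.1.erase q.2, q.2⟩) ?_ ?_ ?_ ?_ ?_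
    · rintro ⟨A, v⟩ hp
      simp only [mem_sigma, mem_powersetCard, Finset.mem_sdiff] at hp ⊢
      obtain ⟨⟨-, hcard⟩, -, hvA⟩ := hp
      refine ⟨⟨subset_univ _, ?_⟩, mem_insert_self v A⟩
      rw [card_insert_of_notMem hvA, hcard]
    · rintro ⟨S, v⟩ hq
      simp only [mem_sigma, mem_powersetCard, Finset.mem_sdiff] at hq ⊢
      obtain ⟨⟨-, hcard⟩, hvS⟩ := hq
      refine ⟨⟨subset_univ _, ?_⟩, mem_univ _, notMem_erase v S⟩
      rw [card_erase_of_mem hvS, hcard, Nat.add_sub_cancel]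
    · rintro ⟨A, v⟩ hp
      simp only [mem_sigma, mem_powersetCard, Finset.mem_sdiff] at hp
      simp only [erase_insert hp.2.2]
    · rintro ⟨S, v⟩ hq
      simp only [mem_sigma, mem_powersetCard] at hq
      simp only [insert_erase hq.2]
    · rintro ⟨A, v⟩ _
      rfl
  -- each `(j+1)`-set is counted `j + 1` times
  have h4 : ∑ S ∈ powersetCard (j + 1) (univ : Finset (Fin n)), ∑ _v ∈ S, g S =
      ((j + 1 : ℕ) : ℝ≥0∞) * ∑ S ∈ powersetCard (j + 1) (univ : Finset (Fin n)), g S := by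
    rw [mul_sum]
    refine sum_congr rfl fun S hS => ?_
    rw [sum_const, (mem_powersetCard.1 hS).2, nsmul_eq_mul]
  rw [h1, h3, ← h2, h4]

/-- **Coupling.** For `j + 1 ≤ n`, the average of `g` over a uniform `(j+1)`-subset `S` of `Fin n`
(`kSubsets n (j+1)`) is the average of `g (insert v A)` over a uniform `j`-subset `A` (`kSubsets n j`) and a
uniform vertex `v ∉ A` (there are `n - j` of them): the double count
`sum_powersetCard_univ_sum_sdiff_insert` and `C(n,j) (n-j) = C(n,j+1) (j+1)` (`Nat.choose_succ_right_eq`,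
`card_kSubsets_eq_choose`). [folklore] -/
theorem avg_kSubsets_succ_eq_avg_insert {j : ℕ} (hj : j + 1 ≤ n) (g : Finset (Fin n) → ℝ≥0∞) :
    ((#(kSubsets n (j + 1)) : ℕ) : ℝ≥0∞)⁻¹ * ∑ S ∈ kSubsets n (j + 1), g S =
      ((#(kSubsets n j) : ℕ) : ℝ≥0∞)⁻¹ * ∑ A ∈ kSubsets n j,
        (((n - j : ℕ) : ℝ≥0∞))⁻¹ * ∑ v ∈ univ \ A, g (insert v A) := by
  have hjn : j ≤ n := Nat.le_of_succ_le hj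
  have hKj : kSubsets n j = powersetCard j univ := by rw [kSubsets, min_eq_left hjn]
  have hKj1 : kSubsets n (j + 1) = powersetCard (j + 1) univ := by rw [kSubsets, min_eq_left hj]
  rw [hKj, hKj1, card_powersetCard, card_powersetCard, card_univ, Fintype.card_fin, ← mul_sum,
    sum_powersetCard_univ_sum_sdiff_insert j g, ← mul_assoc, ← mul_assoc]
  congr 1
  -- the normalisations: `C(n,j+1)⁻¹ = C(n,j)⁻¹ (n-j)⁻¹ (j+1)`
  have hchoose : ((n.choose (j + 1) : ℕ) : ℝ≥0∞) * ((j + 1 : ℕ) : ℝ≥0∞) =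
      ((n.choose j : ℕ) : ℝ≥0∞) * ((n - j : ℕ) : ℝ≥0∞) := by
    rw [← Nat.cast_mul, ← Nat.cast_mul, Nat.choose_succ_right_eq]
  have hc1 : ((n.choose (j + 1) : ℕ) : ℝ≥0∞) ≠ 0 := Nat.cast_ne_zero.2 (Nat.choose_pos hj).ne'
  have hc0 : ((n.choose j : ℕ) : ℝ≥0∞) ≠ 0 := Nat.cast_ne_zero.2 (Nat.choose_pos hjn).ne'
  have hj1 : ((j + 1 : ℕ) : ℝ≥0∞) ≠ 0 := Nat.cast_ne_zero.2 (Nat.succ_ne_zero j)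
  have htop : ∀ m : ℕ, ((m : ℕ) : ℝ≥0∞) ≠ ⊤ := fun m => ENNReal.natCast_ne_top m
  calc ((n.choose (j + 1) : ℕ) : ℝ≥0∞)⁻¹
      = ((n.choose (j + 1) : ℕ) : ℝ≥0∞)⁻¹ * (((j + 1 : ℕ) : ℝ≥0∞)⁻¹ * ((j + 1 : ℕ) : ℝ≥0∞)) := by
        rw [ENNReal.inv_mul_cancel hj1 (htop _), mul_one]
    _ = (((n.choose (j + 1) : ℕ) : ℝ≥0∞) * ((j + 1 : ℕ) : ℝ≥0∞))⁻¹ * ((j + 1 : ℕ) : ℝ≥0∞) := by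
        rw [ENNReal.mul_inv (Or.inl hc1) (Or.inl (htop _)), mul_assoc]
    _ = (((n.choose j : ℕ) : ℝ≥0∞) * ((n - j : ℕ) : ℝ≥0∞))⁻¹ * ((j + 1 : ℕ) : ℝ≥0∞) := by rw [hchoose]
    _ = ((n.choose j : ℕ) : ℝ≥0∞)⁻¹ * ((n - j : ℕ) : ℝ≥0∞)⁻¹ * ((j + 1 : ℕ) : ℝ≥0∞) := by
        rw [ENNReal.mul_inv (Or.inl hc0) (Or.inl (htop _))]

/-! ### The acceptance split for two nested planted sets -/

/-- **Acceptance split, nested planted sets.** For a monotone test `f` and planted sets `S ⊆ T`, the event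
`{x | f (plant T x) = 1}` is the disjoint union of `{x | f (plant S x) = 1}` (`plant S x ≤ plant T x`
pointwise, `plant_mono_set`) and the revival event `{f (plant S x) = 0 ∧ f (plant T x) = 1}`, so its
`G(n,1/2)`-mass is the sum of the two masses. [folklore] -/
theorem erdosRenyiHalf_plant_accept_eq_add_of_subset {S T : Finset (Fin n)} (hST : S ⊆ T)
    {f : EdgeVec n → Bool} (hf : Monotone f) :
    (erdosRenyiHalf n).toOuterMeasure {x | plant T x ∈ {y : EdgeVec n | f y = true}} =
      (erdosRenyiHalf n).toOuterMeasure {x | plant S x ∈ {y : EdgeVec n | f y = true}} +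
        (erdosRenyiHalf n).toOuterMeasure {x | f (plant S x) = false ∧ f (plant T x) = true} := by
  have hset : {x | plant T x ∈ {y : EdgeVec n | f y = true}} =
      {x | plant S x ∈ {y : EdgeVec n | f y = true}} ∪ {x | f (plant S x) = false ∧ f (plant T x) = true} := by
    ext x
    simp only [Set.mem_setOf_eq, Set.mem_union]
    constructor
    · intro hx
      cases hSx : f (plant S x)
      · exact Or.inr ⟨rfl, hx⟩
      · exact Or.inl rfl
    · rintro (hx | ⟨-, hx⟩)
      · exact Bool.le_iff_imp.1 (hf (plant_mono_set hST x)) hx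
      · exact hx
  have hdisj : Disjoint {x | plant S x ∈ {y : EdgeVec n | f y = true}}
      {x | f (plant S x) = false ∧ f (plant T x) = true} := by
    rw [Set.disjoint_left]
    rintro x hx ⟨hx', -⟩
    simp only [Set.mem_setOf_eq] at hx
    rw [hx] at hx'
    exact Bool.noConfusion hx'
  rw [hset, PMF.toOuterMeasure_apply, PMF.toOuterMeasure_apply, PMF.toOuterMeasure_apply, ← ENNReal.tsum_add,
    Set.indicator_union_of_disjoint hdisj]

/-! ### The stage identity -/

/-- **stub_stageIdentity** (the vertex-ignition / stage decomposition, one step). For monotone `f` and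
`j + 1 ≤ n`: acceptance with a planted uniform `(j+1)`-clique `=` acceptance with a planted uniform `j`-clique
`+` the STAGE-`j` REVIVAL mass: the average over `A ∈ kSubsets n j` and a uniform vertex `v ∉ A` of
`Pr_x[f (plant A x) = false ∧ f (plant (insert v A) x) = true]` (the star of `v` into `A` revives `f`).
Proof: the coupling "uniform `(j+1)`-set `=` uniform `j`-set `+` uniform outside vertex"
(`avg_kSubsets_succ_eq_avg_insert`), the fibring `plantedCliqueDist_toOuterMeasure_eq_sum`, and the disjoint
split by monotonicity (`erdosRenyiHalf_plant_accept_eq_add_of_subset` with `A ⊆ insert v A`); the first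
parts of the split do not depend on `v` and `#(univ \ A) = n - j`. [folklore] -/
theorem stub_stageIdentity :
    ∀ (n j : ℕ) (f : EdgeVec n → Bool), Monotone f → j + 1 ≤ n →
      (plantedCliqueDist n (j + 1)).toOuterMeasure {y | f y = true} =
        (plantedCliqueDist n j).toOuterMeasure {y | f y = true} +
          ((#(kSubsets n j) : ℕ) : ℝ≥0∞)⁻¹ * ∑ A ∈ kSubsets n j,
            (((n - j : ℕ) : ℝ≥0∞))⁻¹ * ∑ v ∈ univ \ A,
              (erdosRenyiHalf n).toOuterMeasure
                {x | f (plant A x) = false ∧ f (plant (insert v A) x) = true} := by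
  intro n j f hf hj
  have hjn : j ≤ n := Nat.le_of_succ_le hj
  have hnj : ((n - j : ℕ) : ℝ≥0∞) ≠ 0 := Nat.cast_ne_zero.2 (Nat.sub_pos_of_lt hj).ne'
  rw [plantedCliqueDist_toOuterMeasure_eq_sum, plantedCliqueDist_toOuterMeasure_eq_sum,
    avg_kSubsets_succ_eq_avg_insert hj, ← mul_add, ← sum_add_distrib]
  congr 1
  refine sum_congr rfl fun A hA => ?_
  -- `A` is a `j`-set, so it has `n - j` outside vertices
  have hcard : #(univ \ A) = n - j := by
    rw [card_univ_sdiff, Fintype.card_fin, card_of_mem_kSubsets hA, min_eq_left hjn]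
  rw [sum_congr rfl fun v _ => erdosRenyiHalf_plant_accept_eq_add_of_subset (subset_insert v A) hf,
    sum_add_distrib, mul_add, sum_const, nsmul_eq_mul, ← mul_assoc, hcard,
    ENNReal.inv_mul_cancel hnj (ENNReal.natCast_ne_top _), one_mul]

end Summit.PneNP.PneNP.Theorems.MonotoneBlind.VertexCover
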